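import Mathlib.Data.Nat.Choose.Cast
import Literature.Barriers.CriticalPhenomena.RigorousRGSmallParameterTphiHeat
import HarnessLib

/-!
# `RigorousRGSmallParameter` (Slade, Theorem 1.4.1): the algebra of the heat operator `e^{tΔ_C}` —
# Leibniz rule, locality, factorisation on disconnected products, semigroup, and the vanishing of
# `F_C(F,G)` without a `C`-connection

Companion ("proof architecture") file of
`Literature/Barriers/CriticalPhenomena/RigorousRGSmallParameter.lean`, continuing `…TphiHeat`
(the truncated exponential `expLap` = `e^{tΔ_C}` on polynomials). Slade §4.3 builds the
perturbative map from `ℒ_C = ½Δ_C` and `F_C(A,B) = e^{ℒ_C}(e^{-ℒ_C}A)(e^{-ℒ_C}B) - AB` (4.10) and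
uses, for `W_j(V,x) = ½(1 - Loc_x)F_{w_j}(V_x, V(Λ))` (4.11), that `w_j` has FINITE RANGE `½L^j`
("the definition cannot be applied when `j = N` due to torus effects"): `F_{w_j}(V_x, V_y) = 0`
once `|x - y|` exceeds the range, so that `W_j(V,x)` is a local object. This file proves the
underlying algebra at the level of the abstract coefficient calculus (`Tphi.coeff`, any family of
directions `e : Ξ → E`, any `C : Ξ → Ξ → ℝ`):

* Leibniz: `Δ_C(FG) = (Δ_CF)G + F(Δ_CG) + Σ_{u,v}C_{uv}(F_uG_v + F_vG_u)` (`lapC_mul`);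
* coefficient support `𝒩(S)` (`CoeffSupp`) is preserved by `Δ_C`, its powers and `e^{tΔ_C}`;
* for `F ∈ 𝒩(S)`, `G ∈ 𝒩(T)` with NO `C`-connection between `S` and `T` (`Disconnected`):
  `Δ_C(FG) = (Δ_CF)G + F(Δ_CG)`, the divided-power Leibniz rule
  `Δ_C^k(FG)/k! = Σ_{i+j=k}(Δ_C^iF/i!)(Δ_C^jG/j!)` (`dpow_mul_of_disconnected`) and the
  factorisation **`e^{tΔ_C}(FG) = (e^{tΔ_C}F)(e^{tΔ_C}G)`** for polynomials with
  `deg F + deg G ≤ 2A` (`expLap_mul_of_disconnected`);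
* the semigroup property **`e^{sΔ_C}e^{tΔ_C} = e^{(s+t)Δ_C}`** on polynomials of degree `≤ 2A`
  (`expLap_expLap`), `e^{0} = id`;
* hence **`e^{ℒ_C}(e^{-ℒ_C}F · e^{-ℒ_C}G) = FG`**, i.e. `F_C(F,G) = 0`, on disconnected products
  (`expLap_half_mul_eq`).

Sources: G. Slade, arXiv:1611.06169, §4.3; D. C. Brydges, G. Slade [BS-rg-norm] arXiv:1403.7244,
§2 (the Laplacian and Gaussian expectation as `e^{½Δ_C}` on polynomials).

## What this file provides (definitions with proved properties; no named fact)

* `coeff_pair_mul`, **`lapC_mul`**, `CoeffSupp`, `CoeffSupp.coeff/lapC/lapPow/dpow/expLap`,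
  `Disconnected`, `cross_eq_zero`, **`lapC_mul_of_disconnected`**.
* `lapC_const_mul`, `lapC_add`, `lapC_finset_sum`, **`dpow`** (divided powers), `contDiff_dpow`,
  `lapC_dpow`, **`dpow_mul_of_disconnected`**.
* `sum_square_eq_sum_antidiagonal` (truncated Cauchy product), `PolyDeg`, `dpow_eq_zero_of_polyDeg`,
  `expLap_eq_sum_dpow`, **`expLap_mul_of_disconnected`**.
* `lapPow_const_mul`, `lapPow_finset_sum`, `lapPow_lapPow`, **`expLap_expLap`**, `expLap_zero`,
  `PolyDeg.lapC/lapPow/expLap`, `contDiff_expLap`, **`expLap_half_mul_eq`**.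

## References

* [Slade2017] G. Slade, *Critical exponents for long-range O(n) models below the upper critical
  dimension*, Commun. Math. Phys. 358 (2018) 343–436, arXiv:1611.06169 — §4.3.
* [BrydgesSlade2015RGI] D. C. Brydges, G. Slade, *A renormalisation group method. I. Gaussian
  integration and normed algebras*, J. Stat. Phys. 159 (2015) 421–460, arXiv:1403.7244 — §2.
-/

noncomputable section

namespace Literature.Barriers.CriticalPhenomena

namespace LongRangePhi4

namespace Tphi

open Finset
open scoped ContDiff

variable {Ξ : Type*} [Fintype Ξ] {E : Type*} [NormedAddCommGroup E] [NormedSpace ℝ E]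

/-! ### Leibniz rule for `Δ_C` -/

omit [Fintype Ξ] in
/-- The second-order coefficient of a product: `(FG)_{uv} = F_{uv}G + F_uG_v + F_vG_u + FG_{uv}`. [folklore] -/
theorem coeff_pair_mul (e : Ξ → E) {F G : E → ℝ} (hF : ContDiff ℝ ∞ F) (hG : ContDiff ℝ ∞ G) (u v : Ξ) (φ : E) :
    coeff e [u, v] (fun ψ => F ψ * G ψ) φ =
      coeff e [u, v] F φ * G φ + coeff e [u] F φ * coeff e [v] G φ + coeff e [v] F φ * coeff e [u] G φ +
        F φ * coeff e [u, v] G φ := by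
  rw [coeff_mul e hF hG [u, v]]
  simp [splits, coeff_nil]
  ring

/-- **Leibniz rule for the Laplacian**:
`Δ_C(FG) = (Δ_CF)G + F(Δ_CG) + Σ_{u,v} C_{uv}(F_uG_v + F_vG_u)`. [cite: BrydgesSlade2015RGI, §2 (Gaussian integration by parts; the Laplacian Δ_C = Σ C_{uv}∂_u∂_v)] -/
theorem lapC_mul (e : Ξ → E) (C : Ξ → Ξ → ℝ) {F G : E → ℝ} (hF : ContDiff ℝ ∞ F) (hG : ContDiff ℝ ∞ G) :
    lapC e C (fun ψ => F ψ * G ψ) = fun φ => lapC e C F φ * G φ + F φ * lapC e C G φ +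
      ∑ u, ∑ v, C u v * (coeff e [u] F φ * coeff e [v] G φ + coeff e [v] F φ * coeff e [u] G φ) := by
  funext φ
  simp only [lapC, coeff_pair_mul e hF hG, Finset.sum_mul, Finset.mul_sum, ← Finset.sum_add_distrib]
  refine Finset.sum_congr rfl fun u _ => Finset.sum_congr rfl fun v _ => ?_
  ring

/-! ### Coefficient support (`𝒩(S)`) and its stability under `Δ_C` -/

/-- **`F ∈ 𝒩(S)`** at the level of coefficients: `F_z ≡ 0` whenever a letter of `z` lies outside `S`
("`F_z(φ) = 0` for all `φ` whenever any component of `z` lies outside of `X`"). [cite: BrydgesSlade2015RGI, Definition 3.1 area (𝒩(X)); BrydgesSlade2015RGII, §1.3] -/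
def CoeffSupp (e : Ξ → E) (S : Finset Ξ) (F : E → ℝ) : Prop :=
  ∀ (z : List Ξ) (φ : E), (∃ a ∈ z, a ∉ S) → coeff e z F φ = 0

omit [Fintype Ξ] in
/-- `𝒩(S)` is stable under taking coefficients. [folklore] -/
theorem CoeffSupp.coeff {e : Ξ → E} {S : Finset Ξ} {F : E → ℝ} (h : CoeffSupp e S F) (w : List Ξ) :
    CoeffSupp e S (Tphi.coeff e w F) := by
  intro z φ hz
  rw [coeff_coeff]
  exact h _ φ (by obtain ⟨a, ha, haS⟩ := hz; exact ⟨a, List.mem_append_left _ ha, haS⟩)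

/-- **`Δ_C` preserves `𝒩(S)`.** [folklore] -/
theorem CoeffSupp.lapC {e : Ξ → E} (C : Ξ → Ξ → ℝ) {S : Finset Ξ} {F : E → ℝ} (hF : ContDiff ℝ ∞ F)
    (h : CoeffSupp e S F) : CoeffSupp e S (Tphi.lapC e C F) := by
  intro z φ hz
  rw [coeff_lapC e C hF z]
  refine Finset.sum_eq_zero fun u _ => Finset.sum_eq_zero fun v _ => ?_
  rw [h _ φ (by obtain ⟨a, ha, haS⟩ := hz; exact ⟨a, List.mem_append_left _ ha, haS⟩), mul_zero]

/-- `Δ_C^k` preserves `𝒩(S)`. [folklore] -/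
theorem CoeffSupp.lapPow {e : Ξ → E} (C : Ξ → Ξ → ℝ) {S : Finset Ξ} {F : E → ℝ} (hF : ContDiff ℝ ∞ F)
    (h : CoeffSupp e S F) : ∀ k, CoeffSupp e S (Tphi.lapPow e C k F)
  | 0 => h
  | k + 1 => by rw [lapPow_succ]; exact (CoeffSupp.lapPow C hF h k).lapC C (contDiff_lapPow e C hF k)

/-- **No `C`-connection between `S` and `T`**: `C_{uv} = 0` for `u ∈ S, v ∈ T` and for `u ∈ T, v ∈ S`
(e.g. disjoint supports farther apart than the range of `C`). [cite: Slade2017, §3.1 ("the finite-range property Γ_{j;x,y} = 0 if |x-y| ≥ ½L^j")] -/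
def Disconnected (C : Ξ → Ξ → ℝ) (S T : Finset Ξ) : Prop := ∀ u v, (u ∈ S → v ∈ T → C u v = 0) ∧ (u ∈ T → v ∈ S → C u v = 0)

/-- The cross term of the Leibniz rule vanishes for disconnected supports. [folklore] -/
theorem cross_eq_zero (e : Ξ → E) {C : Ξ → Ξ → ℝ} {S T : Finset Ξ} (hC : Disconnected C S T)
    {F G : E → ℝ} (hFS : CoeffSupp e S F) (hGT : CoeffSupp e T G) (φ : E) :
    ∑ u, ∑ v, C u v * (coeff e [u] F φ * coeff e [v] G φ + coeff e [v] F φ * coeff e [u] G φ) = 0 := by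
  refine Finset.sum_eq_zero fun u _ => Finset.sum_eq_zero fun v _ => ?_
  by_cases huS : u ∈ S
  · by_cases hvT : v ∈ T
    · rw [(hC u v).1 huS hvT, zero_mul]
    · by_cases hvS : v ∈ S
      · by_cases huT : u ∈ T
        · rw [(hC u v).2 huT hvS, zero_mul]
        · rw [hGT [v] φ ⟨v, by simp, hvT⟩, hGT [u] φ ⟨u, by simp, huT⟩]; ring
      · rw [hGT [v] φ ⟨v, by simp, hvT⟩, hFS [v] φ ⟨v, by simp, hvS⟩]; ring
  · by_cases hvS : v ∈ S
    · by_cases huT : u ∈ T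
      · rw [(hC u v).2 huT hvS, zero_mul]
      · rw [hFS [u] φ ⟨u, by simp, huS⟩, hGT [u] φ ⟨u, by simp, huT⟩]; ring
    · rw [hFS [u] φ ⟨u, by simp, huS⟩, hFS [v] φ ⟨v, by simp, hvS⟩]; ring

/-- **`Δ_C(FG) = (Δ_CF)G + F(Δ_CG)` for `C`-disconnected supports.** [folklore] -/
theorem lapC_mul_of_disconnected (e : Ξ → E) {C : Ξ → Ξ → ℝ} {S T : Finset Ξ} (hC : Disconnected C S T)
    {F G : E → ℝ} (hF : ContDiff ℝ ∞ F) (hG : ContDiff ℝ ∞ G) (hFS : CoeffSupp e S F) (hGT : CoeffSupp e T G) :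
    lapC e C (fun ψ => F ψ * G ψ) = fun φ => lapC e C F φ * G φ + F φ * lapC e C G φ := by
  rw [lapC_mul e C hF hG]
  funext φ
  rw [cross_eq_zero e hC hFS hGT φ, add_zero]

/-! ### Linearity of `Δ_C` and divided powers -/

/-- `Δ_C(cF) = cΔ_CF`. [folklore] -/
theorem lapC_const_mul (e : Ξ → E) (C : Ξ → Ξ → ℝ) (c : ℝ) {F : E → ℝ} (hF : ContDiff ℝ ∞ F) :
    lapC e C (fun ψ => c * F ψ) = fun φ => c * lapC e C F φ := by
  funext φ
  simp only [lapC, Finset.mul_sum]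
  refine Finset.sum_congr rfl fun u _ => Finset.sum_congr rfl fun v _ => ?_
  rw [congrFun (coeff_const_mul e hF c [u, v]) φ]
  ring

/-- `Δ_C(F + G) = Δ_CF + Δ_CG`. [folklore] -/
theorem lapC_add (e : Ξ → E) (C : Ξ → Ξ → ℝ) {F G : E → ℝ} (hF : ContDiff ℝ ∞ F) (hG : ContDiff ℝ ∞ G) :
    lapC e C (fun ψ => F ψ + G ψ) = fun φ => lapC e C F φ + lapC e C G φ := by
  funext φ
  simp only [lapC, ← Finset.sum_add_distrib]
  refine Finset.sum_congr rfl fun u _ => Finset.sum_congr rfl fun v _ => ?_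
  rw [congrFun (coeff_add e hF hG [u, v]) φ]
  ring

/-- `Δ_C(Σ_i F_i) = Σ_i Δ_CF_i`. [folklore] -/
theorem lapC_finset_sum (e : Ξ → E) (C : Ξ → Ξ → ℝ) {β : Type*} (s : Finset β) {F : β → E → ℝ}
    (hF : ∀ i ∈ s, ContDiff ℝ ∞ (F i)) :
    lapC e C (fun ψ => ∑ i ∈ s, F i ψ) = fun φ => ∑ i ∈ s, lapC e C (F i) φ := by
  funext φ
  simp only [lapC]
  have h : ∀ u v, coeff e [u, v] (fun ψ => ∑ i ∈ s, F i ψ) φ = ∑ i ∈ s, coeff e [u, v] (F i) φ :=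
    fun u v => congrFun (coeff_finset_sum e s hF [u, v]) φ
  simp only [h, Finset.mul_sum]
  symm
  rw [Finset.sum_comm]
  refine Finset.sum_congr rfl fun u _ => ?_
  rw [Finset.sum_comm]

/-- **The divided powers** `Δ_C^iF/i!`. [folklore] -/
def dpow (e : Ξ → E) (C : Ξ → Ξ → ℝ) (i : ℕ) (F : E → ℝ) : E → ℝ := fun φ => ((i.factorial : ℕ) : ℝ)⁻¹ * lapPow e C i F φ

/-- Divided powers are smooth. [folklore] -/
theorem contDiff_dpow (e : Ξ → E) (C : Ξ → Ξ → ℝ) (i : ℕ) {F : E → ℝ} (hF : ContDiff ℝ ∞ F) : ContDiff ℝ ∞ (dpow e C i F) :=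
  contDiff_const.mul (contDiff_lapPow e C hF i)

/-- `Δ_C(Δ^iF/i!) = (i+1)·Δ^{i+1}F/(i+1)!`. [folklore] -/
theorem lapC_dpow (e : Ξ → E) (C : Ξ → Ξ → ℝ) (i : ℕ) {F : E → ℝ} (hF : ContDiff ℝ ∞ F) :
    lapC e C (dpow e C i F) = fun φ => ((i + 1 : ℕ) : ℝ) * dpow e C (i + 1) F φ := by
  unfold dpow
  rw [lapC_const_mul e C _ (contDiff_lapPow e C hF i)]
  funext φ
  rw [← lapPow_succ, Nat.factorial_succ]
  push_cast
  have h : ((i.factorial : ℕ) : ℝ) ≠ 0 := by positivity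
  field_simp

/-- Divided powers preserve `𝒩(S)`. [folklore] -/
theorem CoeffSupp.dpow {e : Ξ → E} (C : Ξ → Ξ → ℝ) (i : ℕ) {S : Finset Ξ} {F : E → ℝ} (hF : ContDiff ℝ ∞ F)
    (h : CoeffSupp e S F) : CoeffSupp e S (Tphi.dpow e C i F) := by
  intro z φ hz
  unfold Tphi.dpow
  rw [congrFun (coeff_const_mul e (contDiff_lapPow e C hF i) _ z) φ, CoeffSupp.lapPow C hF h i z φ hz, mul_zero]

/-- **Leibniz rule for the divided powers on disconnected products**:
`Δ_C^k(FG)/k! = Σ_{i+j=k} (Δ_C^iF/i!)(Δ_C^jG/j!)`. [folklore] -/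
theorem dpow_mul_of_disconnected (e : Ξ → E) {C : Ξ → Ξ → ℝ} {S T : Finset Ξ} (hC : Disconnected C S T)
    {F G : E → ℝ} (hF : ContDiff ℝ ∞ F) (hG : ContDiff ℝ ∞ G) (hFS : CoeffSupp e S F) (hGT : CoeffSupp e T G) :
    ∀ k : ℕ, dpow e C k (fun ψ => F ψ * G ψ) =
      fun φ => ∑ p ∈ antidiagonal k, dpow e C p.1 F φ * dpow e C p.2 G φ
  | 0 => by funext φ; simp [dpow]
  | k + 1 => by
      have ih := dpow_mul_of_disconnected e hC hF hG hFS hGT k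
      -- `Δ` of the previous identity
      have hΔ : lapC e C (dpow e C k (fun ψ => F ψ * G ψ)) =
          fun φ => ∑ p ∈ antidiagonal k, (((p.1 + 1 : ℕ) : ℝ) * dpow e C (p.1 + 1) F φ * dpow e C p.2 G φ +
            ((p.2 + 1 : ℕ) : ℝ) * (dpow e C p.1 F φ * dpow e C (p.2 + 1) G φ)) := by
        rw [ih, lapC_finset_sum e C _ (fun p _ => (contDiff_dpow e C _ hF).mul (contDiff_dpow e C _ hG))]
        funext φ
        refine Finset.sum_congr rfl fun p _ => ?_
        rw [lapC_mul_of_disconnected e hC (contDiff_dpow e C _ hF) (contDiff_dpow e C _ hG)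
          (CoeffSupp.dpow C _ hF hFS) (CoeffSupp.dpow C _ hG hGT)]
        simp only [lapC_dpow e C _ hF, lapC_dpow e C _ hG]
        ring
      -- left-hand side: `dpow (k+1) (FG) = (k+1)⁻¹ Δ(dpow k (FG))`
      have hL : dpow e C (k + 1) (fun ψ => F ψ * G ψ) = fun φ => (((k + 1 : ℕ) : ℝ))⁻¹ * lapC e C (dpow e C k (fun ψ => F ψ * G ψ)) φ := by
        have h := lapC_dpow e C k (hF.mul hG)
        funext φ
        rw [congrFun h φ, ← mul_assoc, inv_mul_cancel₀ (by positivity), one_mul]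
      rw [hL, hΔ]
      funext φ
      -- regroup the two antidiagonal sums into one over `antidiagonal (k+1)`
      dsimp only
      rw [Finset.sum_add_distrib]
      have hA : ∑ p ∈ antidiagonal k, ((p.1 + 1 : ℕ) : ℝ) * dpow e C (p.1 + 1) F φ * dpow e C p.2 G φ =
          ∑ q ∈ antidiagonal (k + 1), ((q.1 : ℕ) : ℝ) * dpow e C q.1 F φ * dpow e C q.2 G φ := by
        rw [Finset.Nat.sum_antidiagonal_succ]
        simp
      have hB : ∑ p ∈ antidiagonal k, ((p.2 + 1 : ℕ) : ℝ) * (dpow e C p.1 F φ * dpow e C (p.2 + 1) G φ) =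
          ∑ q ∈ antidiagonal (k + 1), ((q.2 : ℕ) : ℝ) * (dpow e C q.1 F φ * dpow e C q.2 G φ) := by
        rw [Finset.Nat.sum_antidiagonal_succ']
        simp
      rw [hA, hB, ← Finset.sum_add_distrib, Finset.mul_sum]
      refine Finset.sum_congr rfl fun q hq => ?_
      rw [Finset.mem_antidiagonal] at hq
      have hq' : ((q.1 : ℕ) : ℝ) + ((q.2 : ℕ) : ℝ) = ((k + 1 : ℕ) : ℝ) := by exact_mod_cast hq
      have hne : ((k + 1 : ℕ) : ℝ) ≠ 0 := by positivity
      calc (((k + 1 : ℕ) : ℝ))⁻¹ * (((q.1 : ℕ) : ℝ) * dpow e C q.1 F φ * dpow e C q.2 G φ +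
            ((q.2 : ℕ) : ℝ) * (dpow e C q.1 F φ * dpow e C q.2 G φ))
          = (((k + 1 : ℕ) : ℝ))⁻¹ * (((q.1 : ℕ) : ℝ) + ((q.2 : ℕ) : ℝ)) * (dpow e C q.1 F φ * dpow e C q.2 G φ) := by ring
        _ = dpow e C q.1 F φ * dpow e C q.2 G φ := by rw [hq', inv_mul_cancel₀ hne, one_mul]

/-! ### A truncated Cauchy product: square sums with vanishing upper triangle -/

omit [Fintype Ξ] in
/-- If `g(i,j) = 0` for `i + j > A` then `Σ_{i,j ≤ A} g(i,j) = Σ_{k ≤ A} Σ_{i+j=k} g(i,j)`. [folklore] -/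
theorem sum_square_eq_sum_antidiagonal {N' : Type*} [AddCommMonoid N'] (A : ℕ) (g : ℕ → ℕ → N')
    (hg : ∀ i j, A < i + j → g i j = 0) :
    ∑ i ∈ range (A + 1), ∑ j ∈ range (A + 1), g i j = ∑ k ∈ range (A + 1), ∑ p ∈ antidiagonal k, g p.1 p.2 := by
  -- right-hand side: `Σ_k Σ_{i ≤ k} g i (k - i)`, then swap the triangular sums
  have hR : ∑ k ∈ range (A + 1), ∑ p ∈ antidiagonal k, g p.1 p.2 =
      ∑ i ∈ range (A + 1), ∑ k ∈ Finset.Ico i (A + 1), g i (k - i) := by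
    rw [Finset.range_eq_Ico, Finset.sum_Ico_Ico_comm]
    refine Finset.sum_congr rfl fun k _ => ?_
    rw [Finset.Nat.sum_antidiagonal_eq_sum_range_succ (fun i j => g i j) k, Finset.range_eq_Ico]
  rw [hR]
  refine Finset.sum_congr rfl fun i hi => ?_
  rw [Finset.mem_range] at hi
  rw [Finset.sum_Ico_eq_sum_range]
  -- `Σ_{j ≤ A} g i j = Σ_{j < A+1-i} g i j`
  have hsplit : range (A + 1) = range (A + 1 - i) ∪ Finset.Ico (A + 1 - i) (A + 1) := by
    rw [Finset.range_eq_Ico, Finset.range_eq_Ico, Finset.Ico_union_Ico_eq_Ico (Nat.zero_le _) (by omega)]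
  rw [hsplit, Finset.sum_union]
  · rw [Finset.sum_eq_zero (s := Finset.Ico (A + 1 - i) (A + 1)) fun j hj => hg i j (by rw [Finset.mem_Ico] at hj; omega),
      add_zero]
    exact Finset.sum_congr rfl fun j _ => by rw [Nat.add_sub_cancel_left]
  · rw [Finset.range_eq_Ico]
    exact Finset.Ico_disjoint_Ico_consecutive 0 _ _

/-! ### Polynomial degree and the exponential `e^{tΔ_C}` in terms of divided powers -/

/-- **`F` is a polynomial of degree `≤ A`**: its coefficients of length `> A` vanish identically. [folklore] -/
def PolyDeg (e : Ξ → E) (A : ℕ) (F : E → ℝ) : Prop := ∀ (φ : E) (z : List Ξ), A < z.length → coeff e z F φ = 0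

/-- `Δ_C^kF/k! = 0` for `2k > deg F`. [folklore] -/
theorem dpow_eq_zero_of_polyDeg (e : Ξ → E) (C : Ξ → Ξ → ℝ) {AF : ℕ} {F : E → ℝ} (hF : ContDiff ℝ ∞ F)
    (hdeg : PolyDeg e AF F) {k : ℕ} (hk : AF < 2 * k) : dpow e C k F = fun _ => 0 := by
  funext φ
  unfold dpow
  rw [lapPow_apply_eq_zero e C hF (hdeg φ) hk, mul_zero]

/-- `e^{tΔ_C}F = Σ_{k ≤ A} t^k Δ_C^kF/k!`. [folklore] -/
theorem expLap_eq_sum_dpow (e : Ξ → E) (C : Ξ → Ξ → ℝ) (A : ℕ) (t : ℝ) (F : E → ℝ) :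
    expLap e C A t F = fun φ => ∑ k ∈ range (A + 1), t ^ k * dpow e C k F φ := by
  funext φ
  simp only [expLap, dpow]
  exact Finset.sum_congr rfl fun k _ => by rw [div_eq_mul_inv]; ring

/-- **Factorisation of `e^{tΔ_C}` on `C`-disconnected products**:
`e^{tΔ_C}(FG) = (e^{tΔ_C}F)(e^{tΔ_C}G)` for `F ∈ 𝒩(S)`, `G ∈ 𝒩(T)` polynomials with
`deg F + deg G ≤ 2A` and no `C`-connection between `S` and `T`. [cite: Slade2017, §4.3 ("The definition cannot be applied when j = N due to torus effects" — the finite range of w_j)] -/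
theorem expLap_mul_of_disconnected (e : Ξ → E) {C : Ξ → Ξ → ℝ} {S T : Finset Ξ} (hC : Disconnected C S T)
    {F G : E → ℝ} (hF : ContDiff ℝ ∞ F) (hG : ContDiff ℝ ∞ G) (hFS : CoeffSupp e S F) (hGT : CoeffSupp e T G)
    {AF AG A : ℕ} (hdF : PolyDeg e AF F) (hdG : PolyDeg e AG G) (hA : AF + AG ≤ 2 * A) (t : ℝ) :
    expLap e C A t (fun ψ => F ψ * G ψ) = fun φ => expLap e C A t F φ * expLap e C A t G φ := by
  rw [expLap_eq_sum_dpow, expLap_eq_sum_dpow, expLap_eq_sum_dpow]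
  funext φ
  rw [Finset.sum_mul_sum]
  -- both sides equal the triangular sum
  have hvan : ∀ i j, A < i + j → t ^ i * dpow e C i F φ * (t ^ j * dpow e C j G φ) = 0 := by
    intro i j hij
    by_cases hi : AF < 2 * i
    · rw [congrFun (dpow_eq_zero_of_polyDeg e C hF hdF hi) φ]; ring
    · have hj : AG < 2 * j := by omega
      rw [congrFun (dpow_eq_zero_of_polyDeg e C hG hdG hj) φ]; ring
  rw [sum_square_eq_sum_antidiagonal A (fun i j => t ^ i * dpow e C i F φ * (t ^ j * dpow e C j G φ)) hvan]
  refine Finset.sum_congr rfl fun k _ => ?_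
  rw [congrFun (dpow_mul_of_disconnected e hC hF hG hFS hGT k) φ, Finset.mul_sum]
  refine Finset.sum_congr rfl fun p hp => ?_
  rw [Finset.mem_antidiagonal] at hp
  rw [← hp, pow_add]
  ring

/-! ### Linearity of the powers and the semigroup property -/

/-- `Δ_C^k(cF) = cΔ_C^kF`. [folklore] -/
theorem lapPow_const_mul (e : Ξ → E) (C : Ξ → Ξ → ℝ) (c : ℝ) {F : E → ℝ} (hF : ContDiff ℝ ∞ F) :
    ∀ k, lapPow e C k (fun ψ => c * F ψ) = fun φ => c * lapPow e C k F φ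
  | 0 => rfl
  | k + 1 => by rw [lapPow_succ, lapPow_const_mul e C c hF k, lapC_const_mul e C c (contDiff_lapPow e C hF k), lapPow_succ]

/-- `Δ_C^k(Σ_i F_i) = Σ_i Δ_C^kF_i`. [folklore] -/
theorem lapPow_finset_sum (e : Ξ → E) (C : Ξ → Ξ → ℝ) {β : Type*} (s : Finset β) {F : β → E → ℝ}
    (hF : ∀ i ∈ s, ContDiff ℝ ∞ (F i)) :
    ∀ k, lapPow e C k (fun ψ => ∑ i ∈ s, F i ψ) = fun φ => ∑ i ∈ s, lapPow e C k (F i) φ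
  | 0 => rfl
  | k + 1 => by
      rw [lapPow_succ, lapPow_finset_sum e C s hF k, lapC_finset_sum e C s (fun i hi => contDiff_lapPow e C (hF i hi) k)]
      rfl

/-- `Δ_C^k Δ_C^l = Δ_C^{k+l}`. [folklore] -/
theorem lapPow_lapPow (e : Ξ → E) (C : Ξ → Ξ → ℝ) (F : E → ℝ) : ∀ k l, lapPow e C k (lapPow e C l F) = lapPow e C (k + l) F
  | 0, l => by simp
  | k + 1, l => by rw [lapPow_succ, lapPow_lapPow e C F k l, Nat.add_right_comm, lapPow_succ]

/-- **The semigroup property on polynomials**: `e^{sΔ_C}e^{tΔ_C}F = e^{(s+t)Δ_C}F` for `deg F ≤ 2A`. [folklore] -/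
theorem expLap_expLap (e : Ξ → E) (C : Ξ → Ξ → ℝ) {AF A : ℕ} {F : E → ℝ} (hF : ContDiff ℝ ∞ F)
    (hdF : PolyDeg e AF F) (hA : AF ≤ 2 * A) (s t : ℝ) :
    expLap e C A s (expLap e C A t F) = expLap e C A (s + t) F := by
  rw [expLap_eq_sum_dpow e C A t, expLap_eq_sum_dpow e C A s, expLap_eq_sum_dpow e C A (s + t)]
  funext φ
  -- expand the left-hand side: `Σ_k s^k Δ^k/k! (Σ_l t^l Δ^l F/l!) = Σ_{k,l} s^k t^l C(k+l,k) Δ^{k+l}F/(k+l)!`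
  have hlin : ∀ k, dpow e C k (fun ψ => ∑ l ∈ range (A + 1), t ^ l * dpow e C l F ψ) φ =
      ∑ l ∈ range (A + 1), s ^ 0 * (t ^ l * (((k + l).choose k : ℕ) : ℝ) * dpow e C (k + l) F φ) := by
    intro k
    unfold dpow
    rw [congrFun (lapPow_finset_sum e C _ (fun l _ => contDiff_const.mul (contDiff_const.mul (contDiff_lapPow e C hF l))) k) φ,
      Finset.mul_sum]
    refine Finset.sum_congr rfl fun l _ => ?_
    have h1 := congrFun (lapPow_const_mul e C (t ^ l) (F := fun ψ => ((l.factorial : ℕ) : ℝ)⁻¹ * lapPow e C l F ψ)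
      (contDiff_const.mul (contDiff_lapPow e C hF l)) k) φ
    have h2 := congrFun (lapPow_const_mul e C (((l.factorial : ℕ) : ℝ)⁻¹) (contDiff_lapPow e C hF l) k) φ
    rw [h1, h2, lapPow_lapPow, Nat.cast_add_choose]
    have hk : ((k.factorial : ℕ) : ℝ) ≠ 0 := by positivity
    have hl : ((l.factorial : ℕ) : ℝ) ≠ 0 := by positivity
    have hkl : (((k + l).factorial : ℕ) : ℝ) ≠ 0 := by positivity
    field_simp
  simp only [hlin, pow_zero, one_mul, Finset.mul_sum]
  -- the vanishing upper triangle
  have hvan : ∀ k l, A < k + l → s ^ k * (t ^ l * (((k + l).choose k : ℕ) : ℝ) * dpow e C (k + l) F φ) = 0 := by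
    intro k l hkl
    rw [congrFun (dpow_eq_zero_of_polyDeg e C hF hdF (k := k + l) (by omega)) φ]; ring
  rw [sum_square_eq_sum_antidiagonal A _ hvan]
  refine Finset.sum_congr rfl fun m _ => ?_
  -- `Σ_{k+l=m} s^k t^l C(m,k) = (s+t)^m`
  rw [add_pow, Finset.sum_mul, Finset.Nat.sum_antidiagonal_eq_sum_range_succ
    (fun k l => s ^ k * (t ^ l * (((k + l).choose k : ℕ) : ℝ) * dpow e C (k + l) F φ)) m]
  refine Finset.sum_congr rfl fun k hk => ?_
  rw [Finset.mem_range] at hk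
  rw [Nat.add_sub_cancel' (by omega)]
  ring

/-- `e^{0·Δ_C}F = F`. [folklore] -/
theorem expLap_zero (e : Ξ → E) (C : Ξ → Ξ → ℝ) (A : ℕ) (F : E → ℝ) : expLap e C A 0 F = F := by
  rw [expLap_eq_sum_dpow]
  funext φ
  rw [Finset.sum_eq_single 0]
  · simp [dpow]
  · intro k _ hk; rw [zero_pow hk, zero_mul]
  · intro h; exact absurd (Finset.mem_range.2 (Nat.succ_pos A)) h

/-! ### Degree and support of `e^{tΔ_C}F`; `F_C(F,G) = 0` on disconnected products -/

/-- `Δ_C` does not increase the degree. [folklore] -/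
theorem PolyDeg.lapC {e : Ξ → E} (C : Ξ → Ξ → ℝ) {A : ℕ} {F : E → ℝ} (hF : ContDiff ℝ ∞ F) (h : PolyDeg e A F) :
    PolyDeg e A (Tphi.lapC e C F) := fun φ z hz =>
  coeff_lapC_eq_zero e C hF (h φ) z (by omega)

/-- `Δ_C^k` does not increase the degree. [folklore] -/
theorem PolyDeg.lapPow {e : Ξ → E} (C : Ξ → Ξ → ℝ) {A : ℕ} {F : E → ℝ} (hF : ContDiff ℝ ∞ F) (h : PolyDeg e A F) :
    ∀ k, PolyDeg e A (Tphi.lapPow e C k F)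
  | 0 => h
  | k + 1 => by rw [lapPow_succ]; exact (PolyDeg.lapPow C hF h k).lapC C (contDiff_lapPow e C hF k)

/-- `e^{tΔ_C}` does not increase the degree. [folklore] -/
theorem PolyDeg.expLap {e : Ξ → E} (C : Ξ → Ξ → ℝ) {AF : ℕ} (A : ℕ) (t : ℝ) {F : E → ℝ} (hF : ContDiff ℝ ∞ F)
    (h : PolyDeg e AF F) : PolyDeg e AF (Tphi.expLap e C A t F) := by
  intro φ z hz
  unfold Tphi.expLap
  rw [coeff_finset_sum e _ (fun k _ => contDiff_const.mul (contDiff_lapPow e C hF k)) z]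
  refine Finset.sum_eq_zero fun k _ => ?_
  rw [congrFun (coeff_const_mul e (contDiff_lapPow e C hF k) _ z) φ, PolyDeg.lapPow C hF h k φ z hz, mul_zero]

/-- `e^{tΔ_C}` preserves `𝒩(S)`. [folklore] -/
theorem CoeffSupp.expLap {e : Ξ → E} (C : Ξ → Ξ → ℝ) (A : ℕ) (t : ℝ) {S : Finset Ξ} {F : E → ℝ} (hF : ContDiff ℝ ∞ F)
    (h : CoeffSupp e S F) : CoeffSupp e S (Tphi.expLap e C A t F) := by
  intro z φ hz
  unfold Tphi.expLap
  rw [coeff_finset_sum e _ (fun k _ => contDiff_const.mul (contDiff_lapPow e C hF k)) z]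
  refine Finset.sum_eq_zero fun k _ => ?_
  rw [congrFun (coeff_const_mul e (contDiff_lapPow e C hF k) _ z) φ, CoeffSupp.lapPow C hF h k z φ hz, mul_zero]

/-- `e^{tΔ_C}F` is smooth. [folklore] -/
theorem contDiff_expLap (e : Ξ → E) (C : Ξ → Ξ → ℝ) (A : ℕ) (t : ℝ) {F : E → ℝ} (hF : ContDiff ℝ ∞ F) :
    ContDiff ℝ ∞ (expLap e C A t F) := by
  unfold expLap
  exact ContDiff.sum fun k _ => contDiff_const.mul (contDiff_lapPow e C hF k)

/-- **`F_C(F, G) = 0` for `C`-disconnected polynomials**: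
`e^{ℒ_C}(e^{-ℒ_C}F · e^{-ℒ_C}G) = FG` (`ℒ_C = ½Δ_C`) when `F ∈ 𝒩(S)`, `G ∈ 𝒩(T)` have no `C`-connection
— the reason `F_{w_j}(V_x, V_y) = 0` for `|x - y|` beyond the range of `w_j`, so that `W_j(V,x)`
depends on the field near `x` only. [cite: Slade2017, §4.3 (displays (4.10)–(4.11) and "The range of w_j is that of C_j, namely ½L^j")] -/
theorem expLap_half_mul_eq (e : Ξ → E) {C : Ξ → Ξ → ℝ} {S T : Finset Ξ} (hC : Disconnected C S T)
    {F G : E → ℝ} (hF : ContDiff ℝ ∞ F) (hG : ContDiff ℝ ∞ G) (hFS : CoeffSupp e S F) (hGT : CoeffSupp e T G)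
    {AF AG A : ℕ} (hdF : PolyDeg e AF F) (hdG : PolyDeg e AG G) (hA : AF + AG ≤ 2 * A) :
    expLap e C A 2⁻¹ (fun ψ => expLap e C A (-2⁻¹) F ψ * expLap e C A (-2⁻¹) G ψ) = fun φ => F φ * G φ := by
  rw [expLap_mul_of_disconnected e hC (contDiff_expLap e C A _ hF) (contDiff_expLap e C A _ hG)
    (CoeffSupp.expLap C A _ hF hFS) (CoeffSupp.expLap C A _ hG hGT) (PolyDeg.expLap C A _ hF hdF) (PolyDeg.expLap C A _ hG hdG) hA,
    expLap_expLap e C hF hdF (by omega), expLap_expLap e C hG hdG (by omega)]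
  norm_num
  rw [expLap_zero, expLap_zero]

end Tphi

end LongRangePhi4

end Literature.Barriers.CriticalPhenomena

end
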